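import Summits.BirchSwinnertonDyer.Rank1Residual.X11b.AnticyclotomicRestrictionInjective
import Summits.BirchSwinnertonDyer.Rank1Residual.X11b.AnticyclotomicSelmerDual
import Literature.NumberTheory.EllipticCurves.SubgroupSelmerProofs
import Literature.NumberTheory.EllipticCurves.IwasawaSelmerProofs
import Literature.NumberTheory.EllipticCurves.IwasawaEulerCharDualityProofs
import HarnessLib

/-!
# X11b, route R1 — the CONTROL MAP `s : Sel_𝔭^Σ(K, E[p^∞]) → Sel_𝔭^Σ(K_∞, E[p^∞])^Γ` on the
# constructed objects, and its INJECTIVITY on route R1 (JSW17 §3.3.2, first half)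

HONEST FRAMING (cell `b2b-bsdres`, run/shared/lean/b2b/bsd-rank1-residual/, verbatim in every
file): the goal of the cell is to DELETE the COMBINATION-SHAPED residual classes of the
Birch–Swinnerton-Dyer formula for ALL analytic-rank `≤ 1` elliptic curves over `ℚ` — "full BSD
formula for every rank `≤ 1` curve in class `C`" assembled STRICTLY from published theorems — so
that the rank-`≤ 1` remainder becomes exactly the CONSTRUCTION-SHAPED classes, which are TYPED
(missing-input `Prop`s), NOT attempted. This is not "finishing BSD". Sub-cell
`b2b-bsdres-multr1-p1` (X11b, route R1 = Castella 2018 Thm. A re-proved along the author's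
erratum); a RESEARCH ROUTE; no claim beyond the stated class; X11b stays CONSTRUCTION-SHAPED;
nothing here changes a label; no named fact is minted (definitions with bodies and proved theorems
only; no `sorry`).

## Why this file

Route R1's statement of record `R1.bsdp_of_onTree` (gen 8, `AnticyclotomicLogLinks`) reads its
PUB-shaped control input `R1ControlOnTreeAt` (Cas18 Thm. 2.3 ⇐ JSW17 Thm. 3.3.1) on Castella's
CONSTRUCTED Selmer group `Sel_𝔭^Σ(K_∞, E[p^∞])` (`AcSelmer.selmerAc`, gen 8), and gen 9 showed that
this input is, datum by datum, an identity `#H⁰(Γ, Sel_𝔭(K_∞, E[p^∞])) = p^n · #H¹(Γ, ·)`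
(`controlOnTreeAt_iff_card`). Jetchev–Skinner–Wan PROVE that identity (JSW17, arXiv:1512.06894,
§3.3) by comparing `Sel_𝔭(K_∞, E[p^∞])^Γ` with the anticyclotomic Selmer group OVER `K` through
the restriction map

  `s : Sel_𝔭^Σ(K, E[p^∞]) ⟶ Sel_𝔭^Σ(K_∞, E[p^∞])^Γ`

("§3.3.2 … the map `H¹(K, E[p^∞]) → H¹(K_∞, E[p^∞])^Γ` … is injective by (irr_K) …"). This file
CONSTRUCTS `s` on the tree objects and proves the first half of the control argument:

* `Sel_𝔭^Σ(K, E[p^∞]) := selmerOver ⊤ E[p^∞] p 𝔭 Σ` (`selmerAcBase`): Castella's Def. 2.2 with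
  `K_∞` replaced by `K` (`H = ⊤ = Γ_K`, `L = K̄^⊤ = K`) — the SAME three local conditions (strict
  above `𝔭`, relaxed above the other primes over `p`, locally trivial off `p` outside `Σ`);
* FUNCTORIALITY of Castella's local conditions under restriction to a smaller (normal) subgroup
  `H ≤ H'` (`resOfLe_mem_awayKer`, `resOfLe_mem_infKer`, `resOfLe_mem_strictKer`,
  **`resOfLe_mem_selmerOver`**): `res : H¹(K̄^{H'}, M) → H¹(K̄^H, M)` maps `Sel_𝔭^Σ(K̄^{H'}, M)` into
  `Sel_𝔭^Σ(K̄^H, M)` — for ANY discrete `Γ_K`-module `M`;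
* the image of `Sel_𝔭^Σ(K, M)` is fixed by EVERY `conj_γ`, `γ ∈ Γ_K` (`conjH1_resOfLe_top`: inner
  automorphisms act trivially on `H¹(⊤, M)`, tree `conjH1_of_mem_holds`, and `res ∘ conj = conj ∘ res`,
  tree `resOfLe_comp_conjH1_holds`), so `s` lands in `Sel^γ = H⁰(Γ, Sel)` for every `γ`
  (**`controlMap`**, `coe_controlMap_apply`);
* `ker s = Sel_𝔭^Σ(K, E[p^∞]) ⊓ ker (H¹(K, E[p^∞]) → H¹(K_∞, E[p^∞]))` (`controlMap_eq_zero_iff`,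
  `resOfLe_top_eq_zero_iff`: along the bijection `H¹(Γ_K, ·) ≃ H¹(⊤, ·)` of the tree,
  `bijective_resH1Hom_subgroupIncl`, the restriction `res_{⊤ → ker κ}` IS `ResKernel.resSubgroup`);
* **`controlMap_injective_of_fixedPoints_eq_bot`**: `E(K_∞)[p^∞] = 0 ⟹ s` injective (gen 9's
  Lemma 3.1 with `B = 0`, `resSubgroup_kerSubgroup_injective_of_fixedPoints_eq_bot`);
* ROUTE R1: **`controlMap_injective_of_irr_of_ram`** — for `E/ℚ` with `Irr ∧ Ram` at `p ≠ 2`,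
  EVERY quadratic `K`, EVERY `ℤ_p`-extension `κ` of `K`, every `𝔭`, `Σ`, `γ`: `s` is injective
  (gen 8's `E(K_∞)[p^∞] = 0`); on `ChainLocus` / erratum fields (`ChainLocus.controlMap_injective…`);
  consequently **`#Sel_𝔭^Σ(K, E[p^∞]) ∣ #Sel_𝔭^Σ(K_∞, E[p^∞])^γ`** whenever the latter is finite
  (`natCard_selmerAcBase_dvd_of_irr_of_ram`), i.e. the left side of the Euler-characteristic form of
  (CTL)/(IMC∘BDP)@𝟙 DOMINATES Castella's Selmer group over `K`.

What is NOT claimed: the order of `coker s` (JSW17 §3.3.3–3.3.4, local computations at `𝔭`, `𝔭̄`,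
`w ∣ N`), `Sel_𝔭(K, E[p^∞])` vs `Ш(E/K)[p^∞]` and `log_ω P` (§3.3.5, Poitou–Tate), `Sel_Γ = 0` (§3.3.6):
the control theorem stays the PUB-shaped input `R1ControlOnTreeAt`; this is its injectivity half.

References: [JetchevSkinnerWan2017] §3.3 (arXiv:1512.06894 pp. 11–14; shape only); [Castella2018]
Def. 2.2, Thm. 2.3 (arXiv:1704.06608 p. 5); [GreenbergLNM1716] §3 Lemma 3.1 (p. 86), diagram p. 85
(`s_n`, `h_n`); [SerreLocalFields1979] VII.§5 Prop. 3 (inner automorphisms).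
-/

noncomputable section

open scoped Classical

open NumberField IsDedekindDomain Field
open Literature.NumberTheory.EllipticCurves Literature.NumberTheory.EllipticCurves.GreenbergSelmer
open Literature.NumberTheory.GaloisRepresentations

universe u

namespace Summit.BirchSwinnertonDyer.Rank1Residual.X11b.AcSelmer

variable {K : Type u} [Field K] [NumberField K]
/-! ## Functoriality of Castella's local conditions under restriction `H¹(K̄^{H'}, M) → H¹(K̄^H, M)` -/

section Functorial

variable {H H' : Subgroup (absoluteGaloisGroup K)}
variable {M : Type u} [AddCommGroup M] [DistribMulAction (absoluteGaloisGroup K) M]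
  [TopologicalSpace M] [DiscreteTopology M]

/-- Restriction to a smaller subgroup preserves local triviality at a finite place `v`: `res_{H'→H}`
maps `awayKer H' M v` into `awayKer H M v` (transitivity of restriction through `H ⊓ D_v ≤ H' ⊓ D_v`).
[cite: GreenbergLNM1716, §3 p. 85 (the localisation maps commute with restriction)] -/
theorem resOfLe_mem_awayKer (h : H ≤ H') (v : HeightOneSpectrum (𝓞 K)) {c : subgroupH1 H' M}
    (hc : c ∈ awayKer H' M v) : resOfLe M h c ∈ awayKer H M v := by
  rw [awayKer, AddMonoidHom.mem_ker] at hc ⊢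
  have h1 : H ⊓ decomp v ≤ H' ⊓ decomp v := inf_le_inf_right _ h
  rw [← AddMonoidHom.comp_apply, resOfLe_comp_holds,
    show resOfLe M ((inf_le_left : H ⊓ decomp v ≤ H).trans h) =
      (resOfLe M h1).comp (resOfLe M (inf_le_left : H' ⊓ decomp v ≤ H')) from
      (resOfLe_comp_holds h1 _).symm,
    AddMonoidHom.comp_apply, hc, map_zero]

omit [NumberField K] in
/-- Restriction to a smaller subgroup preserves local triviality at an infinite place `w`.
[cite: GreenbergLNM1716, §3 p. 85 (the localisation maps commute with restriction)] -/
theorem resOfLe_mem_infKer (h : H ≤ H') (w : InfinitePlace K) {c : subgroupH1 H' M}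
    (hc : c ∈ infKer H' M w) : resOfLe M h c ∈ infKer H M w := by
  rw [infKer, AddMonoidHom.mem_ker] at hc ⊢
  have h1 : H ⊓ decompInf w ≤ H' ⊓ decompInf w := inf_le_inf_right _ h
  rw [← AddMonoidHom.comp_apply, resOfLe_comp_holds,
    show resOfLe M ((inf_le_left : H ⊓ decompInf w ≤ H).trans h) =
      (resOfLe M h1).comp (resOfLe M (inf_le_left : H' ⊓ decompInf w ≤ H')) from
      (resOfLe_comp_holds h1 _).symm,
    AddMonoidHom.comp_apply, hc, map_zero]

/-- `H ⊓ D_v ≤ H' ⊓ D_v` inside `D_v`, for `H ≤ H'`. [folklore] -/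
theorem decompIn_mono (h : H ≤ H') (v : HeightOneSpectrum (𝓞 K)) : decompIn H v ≤ decompIn H' v :=
  fun x hx ↦ (mem_decompIn_iff H' v x).2 (h ((mem_decompIn_iff H v x).1 hx))
/-- **The strict map commutes with restriction**: for `H ≤ H'` and an ordinary local datum `N` at
`v`, `strictMap_H ∘ res_{H'→H} = res_{(H'⊓D_v)→(H⊓D_v)} ∘ strictMap_{H'}` as maps
`H¹(H', M) → H¹(H ⊓ D_v, M ⧸ M⁺_v)` — both are induced by the compatible pair
`(H ⊓ D_v ↪ H', M ↠ M ⧸ M⁺_v)` (`resH1Hom_comp`). [cite: Greenberg1989, §1 p. 98 (strict condition)] -/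
theorem strictMap_comp_resOfLe (h : H ≤ H') {v : HeightOneSpectrum (𝓞 K)} (N : LocalDatum K M v) :
    (N.strictMap H).comp (resOfLe M h) =
      (resH1Hom (subgroupInclusion (decompIn_mono h v)) (AddMonoidHom.id N.Gr) fun _ _ ↦ rfl).comp
        (N.strictMap H') := by
  rw [LocalDatum.strictMap, LocalDatum.strictMap, resOfLe, resH1Hom_comp, resH1Hom_comp]
  exact resH1Hom_congr (by ext; rfl) (by ext; rfl) _ _

/-- Restriction to a smaller subgroup preserves the STRICT condition at `v` for any ordinary local
datum `N` (in particular Castella's `M⁺_𝔭 = 0`). [cite: Greenberg1989, §1 p. 98 (strict condition)] -/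
theorem resOfLe_mem_strictKer (h : H ≤ H') {v : HeightOneSpectrum (𝓞 K)} (N : LocalDatum K M v)
    {c : subgroupH1 H' M} (hc : c ∈ N.strictKer H') : resOfLe M h c ∈ N.strictKer H := by
  rw [LocalDatum.mem_strictKer_iff] at hc ⊢
  rw [← AddMonoidHom.comp_apply, strictMap_comp_resOfLe h N, AddMonoidHom.comp_apply, hc, map_zero]

variable [H.Normal] [H'.Normal]

/-- **Functoriality of Castella's Selmer group under restriction.** For normal subgroups `H ≤ H'`
of `Γ_K` (fields `K̄^{H'} ⊆ K̄^H`) and ANY discrete `Γ_K`-module `M`, the restriction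
`res : H¹(K̄^{H'}, M) → H¹(K̄^H, M)` maps `Sel_𝔭^Σ(K̄^{H'}, M)` into `Sel_𝔭^Σ(K̄^H, M)`: each of the
three families of local conditions (locally trivial off `p` outside `Σ`, at infinity, strict above
`𝔭`) is imposed after conjugating by every `σ ∈ Γ_K`, and `res ∘ conj_σ = conj_σ ∘ res`
(`resOfLe_comp_conjH1_holds`). The case `H' = ⊤`, `H = ker κ` is the map
`Sel_𝔭^Σ(K, E[p^∞]) → Sel_𝔭^Σ(K_∞, E[p^∞])` of the control theorem.
[cite: JetchevSkinnerWan2017, §3.3 (control; shape only)] [cite: Castella2018, Def. 2.2 (arXiv:1704.06608 p. 5)] -/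
theorem resOfLe_mem_selmerOver (h : H ≤ H') {p : ℕ} {𝔭 : HeightOneSpectrum (𝓞 K)}
    {S : Set (HeightOneSpectrum (𝓞 K))} {c : subgroupH1 H' M} (hc : c ∈ selmerOver H' M p 𝔭 S) :
    resOfLe M h c ∈ selmerOver H M p 𝔭 S := by
  have e : ∀ σ : absoluteGaloisGroup K,
      conjH1 H M σ (resOfLe M h c) = resOfLe M h (conjH1 H' M σ c) := fun σ ↦ by
    rw [← AddMonoidHom.comp_apply, ← resOfLe_comp_conjH1_holds (M := M) h σ,
      AddMonoidHom.comp_apply]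
  rw [mem_selmerOver_iff] at hc ⊢
  refine ⟨fun v hv hvS σ ↦ ?_, fun w σ ↦ ?_, fun σ ↦ ?_⟩
  · rw [e]; exact resOfLe_mem_awayKer h v (hc.1 v hv hvS σ)
  · rw [e]; exact resOfLe_mem_infKer h w (hc.2.1 w σ)
  · rw [e]; exact resOfLe_mem_strictKer h _ (hc.2.2 σ)

omit [NumberField K] [H'.Normal] in
/-- **Classes restricted from `K` are `Γ_K`-invariant**: for every `σ ∈ Γ_K` and `c ∈ H¹(⊤, M)`,
`conj_σ (res_{⊤→H} c) = res_{⊤→H} c` — `conj_σ` on `H¹(⊤, M)` is the identity (inner automorphisms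
act trivially, tree `conjH1_of_mem_holds`) and commutes with restriction
(`resOfLe_comp_conjH1_holds`). Greenberg's "the image of `h_n` is fixed by `Γ_n`" at `n = 0`.
[cite: SerreLocalFields1979, VII.§5 Prop. 3] [cite: GreenbergLNM1716, §3 p. 85] -/
theorem conjH1_resOfLe_top (σ : absoluteGaloisGroup K)
    (c : subgroupH1 (⊤ : Subgroup (absoluteGaloisGroup K)) M) :
    conjH1 H M σ (resOfLe M (le_top : H ≤ ⊤) c) = resOfLe M (le_top : H ≤ ⊤) c := by
  rw [← AddMonoidHom.comp_apply, ← resOfLe_comp_conjH1_holds (M := M) (le_top : H ≤ ⊤) σ,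
    AddMonoidHom.comp_apply, conjH1_of_mem_holds ⊤ M (Subgroup.mem_top σ), AddMonoidHom.id_apply]

omit [NumberField K] [H.Normal] [H'.Normal] in
/-- **`res_{⊤→H}` along the bijection `H¹(Γ_K, M) ≃ H¹(⊤, M)` IS the restriction `H¹(Γ_K, M) → H¹(H, M)`**
(`ResKernel.resSubgroup`): `res_{⊤→H} ∘ res_{Γ_K→⊤} = res_{Γ_K→H}` (one compatible pair,
`resH1Hom_comp`). [folklore] -/
theorem resOfLe_top_comp_resH1Hom_subgroupIncl :
    (resOfLe M (le_top : H ≤ ⊤)).comp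
        (resH1Hom (subgroupIncl (⊤ : Subgroup (absoluteGaloisGroup K))) (AddMonoidHom.id M)
          fun _ _ ↦ rfl) = ResKernel.resSubgroup H M := by
  rw [resOfLe, ResKernel.resSubgroup, resH1Hom_comp]
  exact resH1Hom_congr (by ext; rfl) (by ext; rfl) _ _

omit [NumberField K] [H.Normal] [H'.Normal] in
/-- `res_{⊤→H} c = 0` iff the class `c' ∈ H¹(Γ_K, M)` with `res_{Γ_K→⊤} c' = c` (which exists and is
unique, `bijective_resH1Hom_subgroupIncl`) restricts to `0` in `H¹(H, M)`, i.e. lies in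
`subgroupResKer M H = ker (H¹(K, M) → H¹(K̄^H, M))`. [folklore] -/
theorem resOfLe_top_eq_zero_iff (c : subgroupH1 (⊤ : Subgroup (absoluteGaloisGroup K)) M) :
    resOfLe M (le_top : H ≤ ⊤) c = 0 ↔
      ∃ c' : discreteH1 (absoluteGaloisGroup K) M,
        resH1Hom (subgroupIncl (⊤ : Subgroup (absoluteGaloisGroup K))) (AddMonoidHom.id M)
            (fun _ _ ↦ rfl) c' = c ∧ ResKernel.resSubgroup H M c' = 0 := by
  obtain ⟨c', rfl⟩ := (bijective_resH1Hom_subgroupIncl M ⊤ Subgroup.mem_top).surjective c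
  constructor
  · intro h0
    refine ⟨c', rfl, ?_⟩
    rw [← resOfLe_top_comp_resH1Hom_subgroupIncl, AddMonoidHom.comp_apply, h0]
  · rintro ⟨c'', hc'', h0⟩
    rw [(bijective_resH1Hom_subgroupIncl M ⊤ Subgroup.mem_top).injective hc''] at h0
    rw [← resOfLe_top_comp_resH1Hom_subgroupIncl, AddMonoidHom.comp_apply] at h0
    exact h0

omit [NumberField K] [H.Normal] [H'.Normal] in
/-- **`res_{⊤→H}` is injective when `H¹(Γ_K, M) → H¹(H, M)` is** (same map along the bijection
`H¹(Γ_K, M) ≃ H¹(⊤, M)`). [folklore] -/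
theorem resOfLe_top_injective_of (hinj : Function.Injective (ResKernel.resSubgroup H M)) :
    Function.Injective (resOfLe M (le_top : H ≤ ⊤)) := by
  rw [injective_iff_map_eq_zero]
  intro c hc
  obtain ⟨c', rfl, h0⟩ := (resOfLe_top_eq_zero_iff c).mp hc
  rw [(injective_iff_map_eq_zero _).mp hinj c' h0, map_zero]

end Functorial

/-! ## `Sel_𝔭^Σ(K, E[p^∞])` and the control map `s` -/

section Curve

variable (W : WeierstrassCurve K) (p : ℕ) [Fact p.Prime]
  (κ : ZpExtension K p) (𝔭 : HeightOneSpectrum (𝓞 K)) (S : Set (HeightOneSpectrum (𝓞 K)))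

/-- **`Sel_𝔭^Σ(K, E[p^∞]) ⊆ H¹(⊤, E[p^∞]) ≅ H¹(K, E[p^∞])`** — Castella's anticyclotomic Selmer group
OVER `K` (Def. 2.2 with `K_∞` replaced by `K`; JSW17 §3.3.1's `Sel_{𝔭̄-rel, 𝔭-str}`-type group
"`X_ac(K)`"): the classes of `H¹(⊤, E[p^∞])` that are trivial at every place above a finite
`w ∉ Σ`, `w ∤ p` and at infinity, STRICT (trivial in `H¹(K_𝔭, E[p^∞])`) at `𝔭`, unconstrained at
the other places above `p` — `selmerOver` for `H = ⊤`. On `H¹(⊤, ·)` the conjugations `conj_σ` are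
the identity, so each family of conditions is one condition at the chosen decomposition group.
[cite: Castella2018, Def. 2.2 (arXiv:1704.06608 p. 5)] [cite: JetchevSkinnerWan2017, §3.3 (control; shape only)] -/
def selmerAcBase : AddSubgroup (W.subgroupH1 p (⊤ : Subgroup (absoluteGaloisGroup K))) :=
  selmerOver ⊤ (W.geomPrimaryTorsion p) p 𝔭 S

variable {W p κ 𝔭 S}

/-- `res_{K → K_∞}` maps `Sel_𝔭^Σ(K, E[p^∞])` into `Sel_𝔭^Σ(K_∞, E[p^∞])` (`resOfLe_mem_selmerOver`).
[cite: JetchevSkinnerWan2017, §3.3 (control; shape only)] -/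
theorem resOfLe_mem_selmerAc {c : W.subgroupH1 p (⊤ : Subgroup (absoluteGaloisGroup K))}
    (hc : c ∈ selmerAcBase W p 𝔭 S) :
    W.resOfLe p (le_top : κ.kerSubgroup ≤ ⊤) c ∈ selmerAc W p κ 𝔭 S :=
  resOfLe_mem_selmerOver le_top hc

/-- … and the image is fixed by `conj_γ` for EVERY `γ ∈ Γ_K`, i.e. lies in
`Sel^γ = ker (conj_γ − 1) = H⁰(⟨γ⟩, Sel_𝔭^Σ(K_∞, E[p^∞]))` (`conjH1_resOfLe_top`).
[cite: GreenbergLNM1716, §3 p. 85 ("the image of `h_n` is contained in the `Γ_n`-invariants")] -/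
theorem resOfLe_mem_endInvariants (γ : absoluteGaloisGroup K)
    {c : W.subgroupH1 p (⊤ : Subgroup (absoluteGaloisGroup K))} (hc : c ∈ selmerAcBase W p 𝔭 S) :
    (⟨W.resOfLe p (le_top : κ.kerSubgroup ≤ ⊤) c, resOfLe_mem_selmerAc hc⟩ : selmerAc W p κ 𝔭 S) ∈
      IwasawaDual.endInvariants (conjSelmerAc W p κ 𝔭 S γ - 1) := by
  rw [IwasawaDual.mem_endInvariants_iff, IwasawaDual.End_sub_apply, AddMonoid.End.one_apply,
    sub_eq_zero]
  exact Subtype.ext (conjH1_resOfLe_top γ c)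

variable (W p κ 𝔭 S)

/-- **The control map `s : Sel_𝔭^Σ(K, E[p^∞]) → Sel_𝔭^Σ(K_∞, E[p^∞])^γ`** (JSW17 §3.3.2; Greenberg's
`s_0` for Castella's local conditions): restriction of classes from `K` to `K_∞ = K̄^{ker κ}`,
corestricted to the `γ`-invariants `Sel^γ = ker (conj_γ − 1)` of Castella's Selmer group (for ANY
`γ ∈ Γ_K`; for a topological generator `γ` of `Gal(K_∞/K)` this is `H⁰(Γ, Sel_𝔭^Σ(K_∞, E[p^∞]))`,
the left side of the Euler-characteristic form of (CTL), `controlOnTreeAt_iff_card`).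
[cite: JetchevSkinnerWan2017, §3.3 (control; shape only)] [cite: GreenbergLNM1716, §3 p. 85 (`s_n`)] -/
def controlMap (γ : absoluteGaloisGroup K) :
    selmerAcBase W p 𝔭 S →+ IwasawaDual.endInvariants (conjSelmerAc W p κ 𝔭 S γ - 1) where
  toFun c := ⟨⟨W.resOfLe p (le_top : κ.kerSubgroup ≤ ⊤) c, resOfLe_mem_selmerAc c.2⟩,
    resOfLe_mem_endInvariants γ c.2⟩
  map_zero' := Subtype.ext (Subtype.ext (by simp))
  map_add' a b := Subtype.ext (Subtype.ext (by simp))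

variable {W p κ 𝔭 S}

/-- Unfolding `controlMap`: on underlying classes it is `res_{K → K_∞}`. [folklore] -/
@[simp]
theorem coe_controlMap_apply (γ : absoluteGaloisGroup K) (c : selmerAcBase W p 𝔭 S) :
    (((controlMap W p κ 𝔭 S γ c : IwasawaDual.endInvariants (conjSelmerAc W p κ 𝔭 S γ - 1)) :
        selmerAc W p κ 𝔭 S) : W.subgroupH1 p κ.kerSubgroup) =
      W.resOfLe p (le_top : κ.kerSubgroup ≤ ⊤) c :=
  rfl

/-- `s c = 0 ↔ res_{K→K_∞} c = 0` in `H¹(K_∞, E[p^∞])`: **`ker s = Sel_𝔭^Σ(K, E[p^∞]) ⊓ ker res`**.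
[cite: GreenbergLNM1716, §3 p. 86 ("`ker(s_n) ⊆ ker(h_n)`")] -/
theorem controlMap_eq_zero_iff (γ : absoluteGaloisGroup K) (c : selmerAcBase W p 𝔭 S) :
    controlMap W p κ 𝔭 S γ c = 0 ↔
      W.resOfLe p (le_top : κ.kerSubgroup ≤ ⊤) (c : W.subgroupH1 p ⊤) = 0 := by
  rw [← coe_controlMap_apply γ c]
  exact ⟨fun h ↦ by rw [h]; rfl, fun h ↦ Subtype.ext (Subtype.ext h)⟩

/-- **`s` is injective as soon as `H¹(K, E[p^∞]) → H¹(K_∞, E[p^∞])` is** (`ker s ⊆ ker h_0`).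
[cite: GreenbergLNM1716, §3 p. 86 ("`ker(s_n) ⊆ ker(h_n)`")] -/
theorem controlMap_injective_of (γ : absoluteGaloisGroup K)
    (hinj : Function.Injective
      (ResKernel.resSubgroup κ.kerSubgroup (W.geomPrimaryTorsion p))) :
    Function.Injective (controlMap W p κ 𝔭 S γ) := by
  rw [injective_iff_map_eq_zero]
  intro c hc
  rw [controlMap_eq_zero_iff] at hc
  exact Subtype.ext ((injective_iff_map_eq_zero _).mp (resOfLe_top_injective_of hinj) _ hc)

/-- **`E(K_∞)[p^∞] = 0 ⟹ s` injective** (Greenberg's Lemma 3.1 with `B = 0`, gen 9's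
`resSubgroup_kerSubgroup_injective_of_fixedPoints_eq_bot`), for every elliptic `E/K`, every
`ℤ_p`-extension `κ` with a topological generator `γ₀`, every `𝔭`, `Σ`, `γ`.
[cite: GreenbergLNM1716, §3 Lemma 3.1 (p. 86)] [cite: JetchevSkinnerWan2017, §3.3 (control; shape only)] -/
theorem controlMap_injective_of_fixedPoints_eq_bot {γ₀ : absoluteGaloisGroup K}
    (hγ₀ : κ.IsTopGenerator γ₀)
    (hB : FixedPoints.addSubgroup κ.kerSubgroup (W.geomPrimaryTorsion p) = ⊥)
    (γ : absoluteGaloisGroup K) : Function.Injective (controlMap W p κ 𝔭 S γ) :=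
  controlMap_injective_of γ (resSubgroup_kerSubgroup_injective_of_fixedPoints_eq_bot W p κ hγ₀ hB)

/-- **Counting form.** If `s` is injective and `Sel^γ` is finite then `Sel_𝔭^Σ(K, E[p^∞])` is finite
and `#Sel_𝔭^Σ(K, E[p^∞]) ∣ #Sel^γ` (an injective homomorphism into a finite group). [folklore] -/
theorem natCard_selmerAcBase_dvd_of_injective (γ : absoluteGaloisGroup K)
    (hinj : Function.Injective (controlMap W p κ 𝔭 S γ))
    [Finite (IwasawaDual.endInvariants (conjSelmerAc W p κ 𝔭 S γ - 1))] :
    Finite (selmerAcBase W p 𝔭 S) ∧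
      Nat.card (selmerAcBase W p 𝔭 S) ∣
        Nat.card (IwasawaDual.endInvariants (conjSelmerAc W p κ 𝔭 S γ - 1)) := by
  haveI : Finite (selmerAcBase W p 𝔭 S) := Finite.of_injective _ hinj
  exact ⟨this, AddSubgroup.card_dvd_of_injective _ hinj⟩

end Curve

end Summit.BirchSwinnertonDyer.Rank1Residual.X11b.AcSelmer

/-! ## Route R1: `Irr ∧ Ram`, `K` quadratic, any `ℤ_p`-extension — `s` is injective -/

namespace Summit.BirchSwinnertonDyer.Rank1Residual.X11b

open AcSelmer WeierstrassCurve Literature.NumberTheory.EllipticCurves.Rank1Residual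

section RouteR1

variable (W : WeierstrassCurve ℚ) [W.IsElliptic] [W.IsGloballyMinimal] (p : ℕ) [Fact p.Prime]

/-- **JSW17 §3.3.2, first half, on route R1's objects: the control map
`s : Sel_𝔭^Σ(K, E[p^∞]) → Sel_𝔭^Σ(K_∞, E[p^∞])^γ` is INJECTIVE** for `E/ℚ` with `E[p]` irreducible
and ramified at some multiplicative prime (`Irr ∧ Ram`, `p ≠ 2`), EVERY quadratic field `K`, EVERY
`ℤ_p`-extension `κ` of `K` (in particular the anticyclotomic one), every distinguished prime `𝔭`,
every `Σ`, every `γ ∈ Γ_K`: gen 8's `E(K_∞)[p^∞] = 0` (`fixedPoints_kerSubgroup_eq_bot_of_irr_of_ram`)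
makes `H¹(K, E[p^∞]) → H¹(K_∞, E[p^∞])` injective (gen 9), and `ker s ⊆ ker` of that map.
[cite: JetchevSkinnerWan2017, §3.3 (control; shape only)] [cite: GreenbergLNM1716, §3 Lemma 3.1 (p. 86)] [cite: Castella2018Erratum, Lemma 2.1 and Remark p. 2] -/
theorem controlMap_injective_of_irr_of_ram (hp2 : p ≠ 2) (hirr : Irr W p) (hram : Ram W p)
    (K : Type) [Field K] [NumberField K] (hK : Module.finrank ℚ K = 2) (κ : ZpExtension K p)
    (𝔭 : HeightOneSpectrum (𝓞 K)) (S : Set (HeightOneSpectrum (𝓞 K)))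
    (γ : absoluteGaloisGroup K) :
    Function.Injective (controlMap (W.baseChange K) p κ 𝔭 S γ) :=
  controlMap_injective_of γ (resSubgroup_kerSubgroup_injective_of_irr_of_ram W p hp2 hirr hram K hK κ)

/-- **Counting form on route R1**: under `Irr ∧ Ram` (`p ≠ 2`), for every quadratic `K`, `κ`, `𝔭`,
`Σ`, `γ`: if `Sel_𝔭^Σ(K_∞, E[p^∞])^γ` is finite — e.g. under the Euler-characteristic form of (CTL)
or of the open input (IMC∘BDP)@𝟙 (`controlOnTreeAt_iff_card`, `imcWaldspurgerOnTreeAt_iff_card`) —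
then Castella's Selmer group OVER `K` is finite and **`#Sel_𝔭^Σ(K, E[p^∞]) ∣ #Sel_𝔭^Σ(K_∞, E[p^∞])^γ`**.
[cite: JetchevSkinnerWan2017, §3.3 (control; shape only)] -/
theorem natCard_selmerAcBase_dvd_of_irr_of_ram (hp2 : p ≠ 2) (hirr : Irr W p) (hram : Ram W p)
    (K : Type) [Field K] [NumberField K] (hK : Module.finrank ℚ K = 2) (κ : ZpExtension K p)
    (𝔭 : HeightOneSpectrum (𝓞 K)) (S : Set (HeightOneSpectrum (𝓞 K))) (γ : absoluteGaloisGroup K)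
    [Finite (IwasawaDual.endInvariants (conjSelmerAc (W.baseChange K) p κ 𝔭 S γ - 1))] :
    Finite (selmerAcBase (W.baseChange K) p 𝔭 S) ∧
      Nat.card (selmerAcBase (W.baseChange K) p 𝔭 S) ∣
        Nat.card (IwasawaDual.endInvariants (conjSelmerAc (W.baseChange K) p κ 𝔭 S γ - 1)) :=
  natCard_selmerAcBase_dvd_of_injective γ
    (controlMap_injective_of_irr_of_ram W p hp2 hirr hram K hK κ 𝔭 S γ)

/-- **On route R1's population (`ChainLocus`)**: `s` is injective for every quadratic `K`, every
`ℤ_p`-extension, every `𝔭`, `Σ`, `γ`. [cite: JetchevSkinnerWan2017, §3.3 (control; shape only)] [cite: Castella2018Erratum, Thm. A′ (p. 1)] -/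
theorem ChainLocus.controlMap_injective {W : WeierstrassCurve ℚ} [W.IsElliptic]
    [W.IsGloballyMinimal] {p : ℕ} [Fact p.Prime] (h : ChainLocus W p)
    (K : Type) [Field K] [NumberField K] (hK : Module.finrank ℚ K = 2) (κ : ZpExtension K p)
    (𝔭 : HeightOneSpectrum (𝓞 K)) (S : Set (HeightOneSpectrum (𝓞 K)))
    (γ : absoluteGaloisGroup K) :
    Function.Injective (controlMap (W.baseChange K) p κ 𝔭 S γ) :=
  controlMap_injective_of γ (h.resSubgroup_kerSubgroup_injective K hK κ)

/-- **On an erratum field** of route R1: `s` is injective for every `ℤ_p`-extension `κ` of `K`, every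
`𝔭`, `Σ`, `γ` — in particular for THE anticyclotomic `κ`, a topological generator `γ` and a
degree-one `𝔭 ∣ p`, the data of `R1ControlOnTreeAt` / `R1OpenInputOnTreeAt`.
[cite: JetchevSkinnerWan2017, §3.3 (control; shape only)] [cite: Castella2018Erratum, Lemma 2.1 and Thm. 1.1 (i)] -/
theorem ChainLocus.controlMap_injective_of_isErratumField {W : WeierstrassCurve ℚ} [W.IsElliptic]
    [W.IsGloballyMinimal] {p : ℕ} [Fact p.Prime] (h : ChainLocus W p) {q : ℕ}
    (K : Type) [Field K] [NumberField K] (hKf : IsErratumField W K q) (κ : ZpExtension K p)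
    (𝔭 : HeightOneSpectrum (𝓞 K)) (S : Set (HeightOneSpectrum (𝓞 K)))
    (γ : absoluteGaloisGroup K) :
    Function.Injective (controlMap (W.baseChange K) p κ 𝔭 S γ) :=
  h.controlMap_injective K hKf.1.1 κ 𝔭 S γ

/-- **Counting form on an erratum field**: `#Sel_𝔭^Σ(K, E[p^∞]) ∣ #Sel_𝔭^Σ(K_∞, E[p^∞])^γ` whenever the
right side is finite. [cite: JetchevSkinnerWan2017, §3.3 (control; shape only)] [cite: Castella2018, Thm. 2.3 (arXiv:1704.06608 p. 5)] -/
theorem ChainLocus.natCard_selmerAcBase_dvd_of_isErratumField {W : WeierstrassCurve ℚ}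
    [W.IsElliptic] [W.IsGloballyMinimal] {p : ℕ} [Fact p.Prime] (h : ChainLocus W p) {q : ℕ}
    (K : Type) [Field K] [NumberField K] (hKf : IsErratumField W K q) (κ : ZpExtension K p)
    (𝔭 : HeightOneSpectrum (𝓞 K)) (S : Set (HeightOneSpectrum (𝓞 K))) (γ : absoluteGaloisGroup K)
    [Finite (IwasawaDual.endInvariants (conjSelmerAc (W.baseChange K) p κ 𝔭 S γ - 1))] :
    Finite (selmerAcBase (W.baseChange K) p 𝔭 S) ∧
      Nat.card (selmerAcBase (W.baseChange K) p 𝔭 S) ∣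
        Nat.card (IwasawaDual.endInvariants (conjSelmerAc (W.baseChange K) p κ 𝔭 S γ - 1)) :=
  natCard_selmerAcBase_dvd_of_injective γ (h.controlMap_injective_of_isErratumField K hKf κ 𝔭 S γ)

end RouteR1

end Summit.BirchSwinnertonDyer.Rank1Residual.X11b

end
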